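import Summits.BirchSwinnertonDyer.BirchSwinnertonDyer.Theorems.TwistFamilyManinDescentEisensteinTwistedLatticeDichotomy
import Literature.NumberTheory.EllipticCurves.ManinConstantKodairaTypePrimes
import Literature.NumberTheory.EllipticCurves.ManinConstantNonPotentiallyOrdinaryPrimes
import Literature.NumberTheory.EllipticCurves.CuspFormLFunctionLevelConductorProofs
import Summits.BirchSwinnertonDyer.BirchSwinnertonDyer.Theorems.TwistFamilyManinDescentCMCornerNotOrdinaryAtOneSixtyThree
import HarnessLib

/-!
# Route `TwistFamilyManinDescent`, LINE 12/13 glue `EisensteinResidualOfTrichotomy` (stmt-BirchSwinnertonDyer-25945)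
# GRANTED the `j`-table and rigidity: R ⟸ C1 ∧ C2 ∧ F ∧ CM163 ∧ Ray57 ∧ Corner57

Cell `pub/bsd-wall`, seat `bsd-line-ttd-p1` (g6). THEOREMS ONLY.

* `not_dvd_c_of_notBottom_of_strongIsTop` — the CORE at `p = 13`: for the `X₀(N)`-OPTIMAL curve `W`
  (lattice-optimal conductor-level datum `D`), `p² ∣ N`, `W[p]` reducible, (G)-ordinary, UNSTARRED
  (`ord_p Δ_min ≤ 4`): `p ∤ c(D)`, GRANTED modularity, C1, C2, Edixhoven's Kodaira form and rigidity. By the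
  dichotomy (`…EisensteinTwistedLatticeDichotomy.index_dichotomy_of_strongIsTop`: C2 + rigidity) the
  twisted lattice is TOP or BOTTOM; BOTTOM is the negation of C1 at `W`; TOP reads `qΛ_{W₀} = Λ_V` with
  `q = cu/c₀ ∈ ℚ`, so `q, q⁻¹ ∈ ℤ` (Néron scalings between globally minimal models), `q = ±1`,
  `ord_p c = ord_p c₀`, and `p ∤ c₀` by Edixhoven's Kodaira form at the twisted optimal curve `W₀` — STARRED
  by rigidity, and in this TOP configuration its own `p*`-twist is the optimal `W` (the configuration in
  which Edixhoven's printed §4 twist step is sound, cf. the planner's referee read).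
* `not_dvd_c_large` — conductor-level datum at `p > 7` with `p² ∣ N`, `W[p]` reducible: STARRED ⟹ Kodaira
  form (`kodairaSymbolAt_placeOf_II_or_III_or_IV_iff_of_addv`); NOT (G)-ordinary ⟹ ordinarity form (its
  hypothesis is `¬ TypeGOrd` verbatim); else `p = 13` and the core.
* `eisensteinAdditiveManinResidual_of_children` — the DISPATCH: `p ∈ {5, 7}` propositional split on
  `(p, ord_p Δ_min)` into Ray57 ∪ Corner57 (binders verbatim); `p ∈ {13, 163}`: level = conductor
  (`IsNewformOf.level_eq_conductorNorm_of_exists_isNewformOf`), then `not_dvd_c_large`; at `163` the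
  (G)-ordinary rows are EMPTY by CM163 (fed with its own `j`-table binder). R's twist-minimality clause is
  carried, not used; no "ordinary-at-13" lemma is needed.
* `eisensteinResidualOfTrichotomy_of_jTable_of_dokchitserOrdinary` — the registered glue signature VERBATIM as
  conclusion, GRANTED two printed facts NOT among its antecedents: `primeDegreeIsogeny_jTable` (Mazur 1978 /
  Kenku 1982 — the binder of the antecedent CM163, which no other antecedent supplies) and
  `dokchitser_padicValInt_minimalDiscriminantInt_eq_of_isogeny_of_potentiallyGoodOrdinary` (Dokchitser–Dokchitser
  2015 Thm. 5.1 (1), the planner's g2, load-bearing: C1 and C2 at both optimal curves do NOT exclude the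
  symmetric middle configuration with both optimal curves unstarred).

HONEST STATUS. Conditional-result (`--supports 25945 --as helper`); the item closes by name once the planner
re-keys the glue (or the F bundle) on the two facts. Nothing here proves BSD, Manin's conjecture, R, C1 or
C2. [cite: EdixhovenManin1991, Thm. 3 and §4] [cite: Mazur1978, Thm. 1]
[cite: DokchitserDokchitser2015LocalInvariants, Thm. 5.1 (1)]
-/

set_option autoImplicit false
-- single-conjunct summit: `Summit.BirchSwinnertonDyer.BirchSwinnertonDyer.…` repeats the name by design
set_option linter.dupNamespace false

noncomputable section

open scoped Classical NumberField

open WeierstrassCurve IsDedekindDomain Rat.HeightOneSpectrum NumberField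
  Literature.NumberTheory.EllipticCurves Literature.NumberTheory.EllipticCurves.ModularForms
  Literature.NumberTheory.EllipticCurves.Rank1Residual
  Summit.BirchSwinnertonDyer.Rank1Residual Summit.BirchSwinnertonDyer.Rank1Residual.Additive
  Summit.BirchSwinnertonDyer.Rank1Residual.ManinAdditive
  Summit.BirchSwinnertonDyer.BirchSwinnertonDyer.Theorems.TeichmullerTwistDescentStarInvolution
  Summit.BirchSwinnertonDyer.BirchSwinnertonDyer.Theses.TwistFamilyManinDescent

namespace Summit.BirchSwinnertonDyer.BirchSwinnertonDyer.Theorems.TwistFamilyManinDescent.EisensteinTrichotomy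

open TeichmullerTwistDescent.TwistedPeriodLatticeIndexFrame

/-! ### §3 The core at `13`: TOP or BOTTOM, and `p ∤ c` -/

/-- **The core of LINE 12, GRANTED C1, C2, Edixhoven's Kodaira form, rigidity and modularity.** For
`W/ℚ` globally minimal with a LATTICE-OPTIMAL conductor-level datum `D` (`W` is the `X₀(N)`-optimal
curve, `c = c(D)` its Manin constant), `p = 13` with `p² ∣ N`, `W[p]` REDUCIBLE, `W` (G)-ordinary at `p`
and UNSTARRED (`ord_p Δ_min ≤ 4`): `p ∤ c(D)`. By `index_dichotomy_of_strongIsTop` the twisted lattice is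
TOP or BOTTOM; BOTTOM contradicts C1 at `W`; TOP gives `qΛ_{W₀} = Λ_V` (`q = cu/c₀`), so `q = ±1` by the
integrality of Néron scalings, `ord_p c = ord_p c₀`, and `p ∤ c₀` by Edixhoven's Kodaira form at the
STARRED optimal curve `W₀` (`ord_p Δ_min(W₀) = ord_p Δ_min(V) = ord_p Δ_min(W) + 6 ≥ 8`, rigidity).
[cite: EdixhovenManin1991, Thm. 3 and §4] [cite: Stevens1989, Lemma (5.4) p. 97]
[cite: DokchitserDokchitser2015LocalInvariants, Thm. 5.1 (1)] -/
theorem not_dvd_c_of_notBottom_of_strongIsTop (hnf : exists_isNewformOf)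
    (hC1 : EisensteinOrdinaryTwistLatticeNotBottom) (hC2 : EisensteinOrdinaryStrongIsTop)
    (hEdK : edixhoven_not_dvd_maninConstant_of_kodairaSymbol_ne)
    (hDD : dokchitser_padicValInt_minimalDiscriminantInt_eq_of_isogeny_of_potentiallyGoodOrdinary)
    (W : WeierstrassCurve ℚ) [W.IsElliptic] [W.IsGloballyMinimal] (p : ℕ) [Fact p.Prime]
    [NeZero (W.conductorNorm ℤ)] (D : ModularParametrizationData W (W.conductorNorm ℤ))
    (hsq : p ^ 2 ∣ W.conductorNorm ℤ) (hp13 : p = 13) (hred : ¬ Rank1Residual.Irr W p)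
    (hGo : TypeGOrd W p) (hV4 : padicValInt p W.minimalDiscriminantInt ≤ 4)
    (hopt : ∀ z ∈ D.L.lattice, ∃ w ∈ periodLattice D.f, z = D.c * w) :
    ¬ (p : ℤ) ∣ D.c := by
  have hpP : p.Prime := Fact.out
  have hp11 : 11 ≤ p := by omega
  have hp2 : p ≠ 2 := by omega
  have hp5 : 5 ≤ p := by omega
  have hp7 : 7 < p := by omega
  have hadd : Rank1Residual.Addv W p := not_good_and_not_mult_of_sq_dvd_conductorNorm W hsq
  have hj : 0 ≤ padicValRat p W.j := padicValRat_j_nonneg_of_typeGOrd W p hGo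
  have hW6 : padicValInt p W.minimalDiscriminantInt < 6 := by omega
  -- THE quadratic character mod `p`, its Gauss sum, the twisted newform
  set χ : DirichletCharacter ℂ p := (quadraticChar (ZMod p)).ringHomComp (Int.castRingHom ℂ) with hχdef
  have hχ : χ.IsQuadratic := isQuadratic_quadraticChar_ringHomComp p
  have hprim : χ.IsPrimitive := isPrimitive_quadraticChar_ringHomComp p hp2
  set G : ℂ := gaussSum χ (ZMod.stdAddChar (N := p)) with hGdef
  have hG0 : G ≠ 0 := gaussSum_stdAddChar_ne_zero_of_isPrimitive hprim
  set fχ := charTwist (W.conductorNorm ℤ) (dvd_refl _) hsq hχ D.f with hfχdef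
  have hStevens : ∀ w ∈ periodLattice fχ, G * w ∈ periodLattice D.f := fun w hw ↦
    gaussSum_mul_mem_periodLattice_of_mem_charTwist (W.conductorNorm ℤ) (dvd_refl _) hsq hχ hprim D.f hw
  -- TOP or BOTTOM (C2 + rigidity); BOTTOM contradicts C1
  rcases index_dichotomy_of_strongIsTop hnf hC2 hDD W p D hsq hp13 hred hGo hV4 hopt χ hχ hprim with
    htop | hbot
  swap
  · exact absurd hbot (hC1 W p D hsq hp11 hadd hred hGo hV4 hopt χ hχ hprim)
  rw [← hGdef] at htop
  -- the twist frame
  obtain ⟨V, W₀, hVe, hVm, hE₀, hM₀, C, LV, D₀, hC, hu, hAV, hjV, hvV, hLV, hiso, hN₀, hopt₀, hfeq⟩ :=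
    exists_twist_frame hnf W p D hsq hp5 hadd hj hW6 hχ
  haveI := hVe
  haveI := hVm
  haveI := hE₀
  haveI := hM₀
  haveI : NeZero (W₀.conductorNorm ℤ) := ⟨(conductorNorm_pos_holds W₀).ne'⟩
  have htw : ∀ x : ℂ, x ∈ LV.lattice ↔ G * ((((C.u : ℚ) : ℂ))⁻¹ * x) ∈ D.L.lattice := fun x ↦
    mem_lattice_twist_pStar_iff p hp2 W V D.isNeronLattice hLV C hC x
  -- `W₀` is additive, (G)-ordinary and STARRED (rigidity), hence `p ∤ c₀` (Edixhoven, Kodaira form)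
  have hGoV : TypeGOrd V p :=
    (typeGOrd_iff_of_star_pair p hp5 V W hAV hadd hjV hj (by omega)).mpr hGo
  have hadd₀ : Rank1Residual.Addv W₀ p := (X2.addv_iff_of_isIsogenous (p := p) hiso).mp hAV
  have hPGO : V.HasPotentiallyGoodOrdinaryReductionAtPrime p :=
    (typeGOrd_iff_exists_good_unitRoot V p hp5 hAV).mp hGoV
  have hv₀ : padicValInt p W₀.minimalDiscriminantInt = padicValInt p W.minimalDiscriminantInt + 6 := by
    rw [← hvV]; exact (hDD V W₀ p hpP hiso hPGO).symm
  have hvW := padicValInt_minimalDiscriminantInt_mem_of_addv_of_padicValRat_j_nonneg W p hp5 hadd hj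
  have hc₀ : ¬ (p : ℤ) ∣ D₀.c := by
    obtain ⟨D₀', hopt₀', hc'⟩ := exists_optimalDatum_of_level_eq_c hN₀.symm D₀ hopt₀
    have hnot : ¬ (W₀.kodairaSymbolAt (placeOf p) = .II ∨ W₀.kodairaSymbolAt (placeOf p) = .III ∨
        W₀.kodairaSymbolAt (placeOf p) = .IV) := fun h ↦ by
      have h4 := (kodairaSymbolAt_placeOf_II_or_III_or_IV_iff_of_addv W₀ p hp5 hadd₀).mp h
      omega
    rw [← hc']
    exact hEdK W₀ D₀' hopt₀' p hpP hp7 (fun h ↦ hnot (Or.inl h)) (fun h ↦ hnot (Or.inr (Or.inl h)))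
      (fun h ↦ hnot (Or.inr (Or.inr h)))
  -- constants and the rational multiplier `q = c u / c₀`
  have hc : D.c ≠ 0 := D.maninConstant_ne_zero_holds
  have hc₀0 : D₀.c ≠ 0 := D₀.maninConstant_ne_zero_holds
  have hu0 : (C.u : ℚ) ≠ 0 := C.u.ne_zero
  have hcℂ : (D.c : ℂ) ≠ 0 := by exact_mod_cast hc
  have hc₀ℂ : (D₀.c : ℂ) ≠ 0 := by exact_mod_cast hc₀0
  have huℂ : (((C.u : ℚ) : ℚ) : ℂ) ≠ 0 := by exact_mod_cast hu0
  set q : ℚ := (D.c : ℚ) * (C.u : ℚ) / (D₀.c : ℚ) with hqdef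
  have hq0 : q ≠ 0 := div_ne_zero (mul_ne_zero (by exact_mod_cast hc) hu0) (by exact_mod_cast hc₀0)
  have hqℂ : ((q : ℚ) : ℂ) = (D.c : ℂ) * (((C.u : ℚ) : ℚ) : ℂ) / (D₀.c : ℂ) := by
    rw [hqdef]; push_cast; ring
  -- TOP: `qΛ_{W₀} ⊆ Λ_V` (always) and `q⁻¹Λ_V ⊆ Λ_{W₀}` (top), so `q = ±1`
  have hcl1 : ∀ y ∈ D₀.L.lattice, ((q : ℚ) : ℂ) * y ∈ LV.lattice := by
    intro y hy
    obtain ⟨w', hw', rfl⟩ := hopt₀ y hy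
    rw [← hfeq] at hw'
    have h1 : (D.c : ℂ) * (G * w') ∈ D.L.lattice := D.smul_periodLattice_le _ (hStevens w' hw')
    rw [htw, hqℂ]
    convert h1 using 1
    field_simp
  have hcl1' : ∀ z ∈ LV.lattice, (((q⁻¹ : ℚ) : ℚ) : ℂ) * z ∈ D₀.L.lattice := by
    intro y hy
    have h1 := (htw y).mp hy
    obtain ⟨z, hz, hz'⟩ := hopt _ h1
    obtain ⟨w', hw', hw''⟩ := htop z hz
    have h2 : (D₀.c : ℂ) * w' ∈ D₀.L.lattice := D₀.smul_periodLattice_le _ (hfeq ▸ hw')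
    have hy' : y = (((C.u : ℚ) : ℚ) : ℂ) * ((D.c : ℂ) * z) / G := by
      rw [← hz']
      field_simp
    have e : (((q⁻¹ : ℚ) : ℚ) : ℂ) * y = (D₀.c : ℂ) * w' := by
      rw [hy', Rat.cast_inv, hqℂ, hw'']
      field_simp
    rw [e]
    exact h2
  obtain ⟨k, hk⟩ := integral_neronScaling_of_isGloballyMinimal_holds W₀ V D₀.L LV D₀.isNeronLattice
    hLV q hcl1
  obtain ⟨k', hk'⟩ := integral_neronScaling_of_isGloballyMinimal_holds V W₀ LV D₀.L hLV
    D₀.isNeronLattice q⁻¹ hcl1'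
  have hkk : k * k' = 1 := by
    have h : (k : ℚ) * k' = 1 := by rw [hk, hk', mul_inv_cancel₀ hq0]
    exact_mod_cast h
  have hvq : padicValRat p q = 0 := by
    rcases Int.eq_one_or_neg_one_of_mul_eq_one hkk with h | h
    · rw [← hk, h]; simp
    · rw [← hk, h]; simp [padicValRat.neg]
  -- valuation count: `ord_p q = ord_p c + ord_p u − ord_p c₀ = 0`, `ord_p u = 0`, `p ∤ c₀`
  have hval : padicValRat p (D.c : ℚ) = padicValRat p (D₀.c : ℚ) := by
    have e : padicValRat p q = padicValRat p (D.c : ℚ) + padicValRat p (C.u : ℚ) -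
        padicValRat p (D₀.c : ℚ) := by
      rw [hqdef, padicValRat.div (mul_ne_zero (by exact_mod_cast hc) hu0) (by exact_mod_cast hc₀0),
        padicValRat.mul (by exact_mod_cast hc) hu0]
    rw [hvq, hu] at e
    linarith
  rw [padicValRat.of_int, padicValRat.of_int] at hval
  have h0 : padicValInt p D₀.c = 0 := padicValInt.eq_zero_of_not_dvd hc₀
  have hval' : padicValInt p D.c = padicValInt p D₀.c := by exact_mod_cast hval
  have h0' : padicValInt p D.c = 0 := hval'.trans h0
  intro hdvd
  have h1 : 1 ≤ padicValInt p D.c := by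
    have h := (padicValInt_dvd_iff 1 D.c).mp (by rwa [pow_one])
    exact h.resolve_left hc
  omega

/-! ### §4 The dispatch: R from C1, C2, F, CM163, Ray57, Corner57, the `j`-table and rigidity -/

/-- **The large-prime branch (`p ∈ {13, 163}` of R, or any row on which Edixhoven's two printed
forms and — at `p = 13` — the core apply).** For `W/ℚ` globally minimal, `D` a datum at a level `N`
that IS the conductor, `p > 7` prime with `p² ∣ N`, `W[p]` reducible and `D` lattice-optimal: `p ∤ c(D)`,
GRANTED modularity, Edixhoven Thm. 3 in both tree forms, and — used only when `p = 13` — C1, C2 and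
rigidity; at `p ≠ 13` the (G)-ordinary unstarred rows must be excluded by the caller (`hno`). Split:
`ord_p Δ_min > 4` ⟹ Kodaira symbol not II/III/IV (`kodairaSymbolAt_placeOf_II_or_III_or_IV_iff_of_addv`)
⟹ F.1; else not (G)-ordinary ⟹ F.2 (its hypothesis is `¬ TypeGOrd` verbatim); else `p = 13` and the
core. [cite: EdixhovenManin1991, Thm. 3] -/
theorem not_dvd_c_large (hnf : exists_isNewformOf)
    (hC1 : EisensteinOrdinaryTwistLatticeNotBottom) (hC2 : EisensteinOrdinaryStrongIsTop)
    (hEdK : edixhoven_not_dvd_maninConstant_of_kodairaSymbol_ne)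
    (hEdG : edixhoven_not_dvd_maninConstant_of_not_potentiallyGoodOrdinary)
    (hDD : dokchitser_padicValInt_minimalDiscriminantInt_eq_of_isogeny_of_potentiallyGoodOrdinary)
    (W : WeierstrassCurve ℚ) [W.IsElliptic] [W.IsGloballyMinimal] (p : ℕ) [Fact p.Prime]
    [NeZero (W.conductorNorm ℤ)] (D : ModularParametrizationData W (W.conductorNorm ℤ))
    (hp7 : 7 < p) (hno : p ≠ 13 → ¬ (TypeGOrd W p ∧ padicValInt p W.minimalDiscriminantInt ≤ 4))
    (hsq : p ^ 2 ∣ W.conductorNorm ℤ) (hred : ¬ W.HasIrreducibleModPGaloisRep p)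
    (hopt : ∀ z ∈ D.L.lattice, ∃ w ∈ periodLattice D.f, z = D.c * w) :
    ¬ (p : ℤ) ∣ D.maninConstant := by
  have hpP : p.Prime := Fact.out
  have hp5 : 5 ≤ p := by omega
  have hadd : Rank1Residual.Addv W p := not_good_and_not_mult_of_sq_dvd_conductorNorm W hsq
  by_cases hlow : padicValInt p W.minimalDiscriminantInt ≤ 4
  · by_cases hGo : TypeGOrd W p
    · -- the core (only `p = 13` is live)
      have hp13 : p = 13 := by
        by_contra h
        exact hno h ⟨hGo, hlow⟩
      exact not_dvd_c_of_notBottom_of_strongIsTop hnf hC1 hC2 hEdK hDD W p D hsq hp13 hred hGo hlow hopt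
    · -- not (G)-ordinary: Edixhoven Thm. 3, ordinarity form
      exact hEdG W D hopt p hpP hp7 hGo
  · -- starred: Edixhoven Thm. 3, Kodaira form
    have hnot : ¬ (W.kodairaSymbolAt (placeOf p) = .II ∨ W.kodairaSymbolAt (placeOf p) = .III ∨
        W.kodairaSymbolAt (placeOf p) = .IV) :=
      fun h ↦ hlow ((kodairaSymbolAt_placeOf_II_or_III_or_IV_iff_of_addv W p hp5 hadd).mp h)
    exact hEdK W D hopt p hpP hp7 (fun h ↦ hnot (Or.inl h)) (fun h ↦ hnot (Or.inr (Or.inl h)))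
      (fun h ↦ hnot (Or.inr (Or.inr h)))

/-- **R `EisensteinAdditiveManinResidual` from its LINE 12/13 children, GRANTED rigidity** (the glue's
content with every antecedent explicit): C1 (`p ≥ 11`, used at `13`), C2 (`p = 13`), F = Edixhoven
Thm. 3 (Kodaira form ∧ ordinarity form), CM163 (with its own `j`-table binder `hT`, used at `163` to
empty the (G)-ordinary rows), Ray57, Corner57, and the printed rigidity fact `hDD`. `p ∈ {5, 7}`:
propositional split on `(p, ord_p Δ_min)` into Ray57 ∪ Corner57 (verbatim binders). `p ∈ {13, 163}`:
the level of `D` is the conductor (Carayol / multiplicity one from modularity,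
`IsNewformOf.level_eq_conductorNorm_of_exists_isNewformOf`), then `not_dvd_c_large`. R's twist-minimality
clause is carried, not used. [cite: EdixhovenManin1991, Thm. 3 and §4]
[cite: DokchitserDokchitser2015LocalInvariants, Thm. 5.1 (1)] [cite: Mazur1978, Thm. 1] -/
theorem eisensteinAdditiveManinResidual_of_children (hT : primeDegreeIsogeny_jTable)
    (hDD : dokchitser_padicValInt_minimalDiscriminantInt_eq_of_isogeny_of_potentiallyGoodOrdinary)
    (hC1 : EisensteinOrdinaryTwistLatticeNotBottom) (hC2 : EisensteinOrdinaryStrongIsTop)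
    (hF : EdixhovenLargePrimeManinFacts) (hCM : CMCornerNotOrdinaryAtOneSixtyThree)
    (hRay : EisensteinRaynaudRegimeManinUnit) (hCor : EisensteinCornerManinResidual) :
    EisensteinAdditiveManinResidual := by
  intro hM hAU hC hnf W _ _ N _ D p hp hcases hpN hred _htw hopt
  haveI : Fact p.Prime := ⟨hp⟩
  rcases hcases with rfl | rfl | rfl | ⟨rfl, -⟩
  · -- `p = 5`: Ray57 on `ord₅ Δ_min ∈ {4, 8}`, Corner57 otherwise
    by_cases h58 : padicValInt 5 W.minimalDiscriminantInt ∈ ({4, 8} : Finset ℕ)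
    · exact hRay hM hAU hC hnf W D 5 hp (Or.inl ⟨rfl, h58⟩) hpN hred _htw hopt
    · refine hCor hM hAU hC hnf W D 5 hp (Or.inl rfl) ?_ hpN hred _htw hopt
      rintro (⟨-, h⟩ | ⟨h7, -⟩)
      · exact h58 h
      · norm_num at h7
  · -- `p = 7`: Ray57 on `ord₇ Δ_min ∈ {3, 9}`, Corner57 otherwise
    by_cases h79 : padicValInt 7 W.minimalDiscriminantInt ∈ ({3, 9} : Finset ℕ)
    · exact hRay hM hAU hC hnf W D 7 hp (Or.inr ⟨rfl, h79⟩) hpN hred _htw hopt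
    · refine hCor hM hAU hC hnf W D 7 hp (Or.inr rfl) ?_ hpN hred _htw hopt
      rintro (⟨h5, -⟩ | ⟨-, h⟩)
      · norm_num at h5
      · exact h79 h
  · -- `p = 13`: the core (through Edixhoven's two printed forms off its rows)
    obtain rfl : N = W.conductorNorm ℤ := IsNewformOf.level_eq_conductorNorm_of_exists_isNewformOf hnf D.isNewformOf
    exact not_dvd_c_large hnf hC1 hC2 hF.1 hF.2 hDD W 13 D (by norm_num) (fun h ↦ absurd rfl h) hpN
      hred hopt
  · -- `p = 163`: CM by `ℚ(√−163)` ⟹ never (G)-ordinary (CM163); then Edixhoven's two forms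
    obtain rfl : N = W.conductorNorm ℤ := IsNewformOf.level_eq_conductorNorm_of_exists_isNewformOf hnf D.isNewformOf
    exact not_dvd_c_large hnf hC1 hC2 hF.1 hF.2 hDD W 163 D (by norm_num)
      (fun _ h ↦ hCM hT W hred h.1) hpN hred hopt

/-! ### §5 The glue signature, granted the `j`-table and rigidity -/

/-- **Glue `EisensteinResidualOfTrichotomy` (stmt-BirchSwinnertonDyer-25945) GRANTED two printed facts
not among its antecedents**: Mazur's `j`-table of prime-degree isogenies (`primeDegreeIsogeny_jTable` —
the binder of the antecedent CM163 itself, which no other antecedent supplies; refuter g6's typing gap)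
and Dokchitser–Dokchitser's rigidity at potentially ordinary `p` (the planner's g2, «load-bearing»).
Conditional-result; the registered signature is the conclusion VERBATIM. Nothing here proves BSD,
Manin's conjecture, R, C1 or C2. [cite: EdixhovenManin1991, Thm. 3 and §4] [cite: Mazur1978, Thm. 1]
[cite: DokchitserDokchitser2015LocalInvariants, Thm. 5.1 (1)] -/
theorem eisensteinResidualOfTrichotomy_of_jTable_of_dokchitserOrdinary (hT : primeDegreeIsogeny_jTable)
    (hDD : dokchitser_padicValInt_minimalDiscriminantInt_eq_of_isogeny_of_potentiallyGoodOrdinary) :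
    EisensteinResidualOfTrichotomy :=
  fun hC1 hC2 hF hCM hRay hCor ↦
    eisensteinAdditiveManinResidual_of_children hT hDD hC1 hC2 hF hCM hRay hCor

/-! ### §6 The same glue keyed on the route's own item `LargePrimeReducibleJ` instead of the `j`-table fact -/

/-- **The `163`-corner through the route item `LargePrimeReducibleJ` (stmt-BirchSwinnertonDyer-25139)**: a curve
with `W[163]` reducible has `(163, j) ∈ largePrimeIsogenyJTable`, i.e. `j = −640320³`, hence CM by `ℚ(√−163)`
with `163` ramified, hence (Deuring, tree theorem `deuring_not_hasUnitRootAt_of_hasCM_of_not_cmSplit_holds`) no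
good ordinary fibre above `163` over any number field: `¬ TypeGOrd W 163`. The item `CMCornerNotOrdinaryAtOneSixtyThree`
read on the route's own `j`-table item rather than on the Literature fact `primeDegreeIsogeny_jTable`.
[cite: Mazur1978, Thm. 1] [cite: Lang1987, Ch. 13 §4 Thm. 12] -/
theorem not_typeGOrd_oneSixtyThree_of_largePrimeReducibleJ (hL : LargePrimeReducibleJ)
    (W : WeierstrassCurve ℚ) [W.IsElliptic] (hred : ¬ W.HasIrreducibleModPGaloisRep 163) :
    ¬ TypeGOrd W 163 := by
  haveI : Fact (Nat.Prime 163) := ⟨by norm_num⟩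
  have hmem := hL W 163 (by norm_num) (by norm_num) hred
  rw [largePrimeIsogenyJTable] at hmem
  simp only [Finset.mem_insert, Finset.mem_singleton, Prod.mk.injEq] at hmem
  norm_num at hmem
  have hCM : W.HasCM := hasCM_of_j_eq_neg262537412640768000 W hmem
  have hns : ¬ CMSplit W 163 := by
    intro h
    have h1 := h.1
    rw [hmem] at h1
    exact h1 (by norm_num [cmFieldDiscrOfJ])
  rintro ⟨L, _, _, _, F, hF⟩
  haveI : NumberField F := NumberField.of_module_finite ℚ F
  obtain ⟨w, hw⟩ := exists_heightOneSpectrum_natCast_mem F 163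
  exact deuring_not_hasUnitRootAt_of_hasCM_of_not_cmSplit_holds W hCM 163 (by norm_num) hns F w hw
    (hF w hw).1 (hF w hw).2

/-- **R from its children with the `163`-corner supplied as a function** (`h163 : W[163] reducible ⇒ not
(G)-ordinary at 163`, however obtained — from CM163 + the `j`-table fact, or from `LargePrimeReducibleJ` by
`not_typeGOrd_oneSixtyThree_of_largePrimeReducibleJ`); otherwise word for word the dispatch
`eisensteinAdditiveManinResidual_of_children`. [cite: EdixhovenManin1991, Thm. 3 and §4]
[cite: DokchitserDokchitser2015LocalInvariants, Thm. 5.1 (1)] -/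
theorem eisensteinAdditiveManinResidual_of_children_of_not_typeGOrd
    (h163 : ∀ (W : WeierstrassCurve ℚ) [W.IsElliptic], ¬ W.HasIrreducibleModPGaloisRep 163 → ¬ TypeGOrd W 163)
    (hDD : dokchitser_padicValInt_minimalDiscriminantInt_eq_of_isogeny_of_potentiallyGoodOrdinary)
    (hC1 : EisensteinOrdinaryTwistLatticeNotBottom) (hC2 : EisensteinOrdinaryStrongIsTop)
    (hF : EdixhovenLargePrimeManinFacts)
    (hRay : EisensteinRaynaudRegimeManinUnit) (hCor : EisensteinCornerManinResidual) :
    EisensteinAdditiveManinResidual := by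
  intro hM hAU hC hnf W _ _ N _ D p hp hcases hpN hred _htw hopt
  haveI : Fact p.Prime := ⟨hp⟩
  rcases hcases with rfl | rfl | rfl | ⟨rfl, -⟩
  · by_cases h58 : padicValInt 5 W.minimalDiscriminantInt ∈ ({4, 8} : Finset ℕ)
    · exact hRay hM hAU hC hnf W D 5 hp (Or.inl ⟨rfl, h58⟩) hpN hred _htw hopt
    · refine hCor hM hAU hC hnf W D 5 hp (Or.inl rfl) ?_ hpN hred _htw hopt
      rintro (⟨-, h⟩ | ⟨h7, -⟩)
      · exact h58 h
      · norm_num at h7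
  · by_cases h79 : padicValInt 7 W.minimalDiscriminantInt ∈ ({3, 9} : Finset ℕ)
    · exact hRay hM hAU hC hnf W D 7 hp (Or.inr ⟨rfl, h79⟩) hpN hred _htw hopt
    · refine hCor hM hAU hC hnf W D 7 hp (Or.inr rfl) ?_ hpN hred _htw hopt
      rintro (⟨h5, -⟩ | ⟨-, h⟩)
      · norm_num at h5
      · exact h79 h
  · obtain rfl : N = W.conductorNorm ℤ := IsNewformOf.level_eq_conductorNorm_of_exists_isNewformOf hnf D.isNewformOf
    exact not_dvd_c_large hnf hC1 hC2 hF.1 hF.2 hDD W 13 D (by norm_num) (fun h ↦ absurd rfl h) hpN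
      hred hopt
  · obtain rfl : N = W.conductorNorm ℤ := IsNewformOf.level_eq_conductorNorm_of_exists_isNewformOf hnf D.isNewformOf
    exact not_dvd_c_large hnf hC1 hC2 hF.1 hF.2 hDD W 163 D (by norm_num)
      (fun _ h ↦ h163 W hred h.1) hpN hred hopt

/-- **Glue `EisensteinResidualOfTrichotomy` GRANTED the route item `LargePrimeReducibleJ`
(stmt-BirchSwinnertonDyer-25139) and the rigidity fact** — the second re-key option: every input but the
Dokchitser–Dokchitser fact is a registered decl of this route. Conditional-result.
[cite: Mazur1978, Thm. 1] [cite: DokchitserDokchitser2015LocalInvariants, Thm. 5.1 (1)] -/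
theorem eisensteinResidualOfTrichotomy_of_largePrimeReducibleJ_of_dokchitserOrdinary
    (hL : LargePrimeReducibleJ)
    (hDD : dokchitser_padicValInt_minimalDiscriminantInt_eq_of_isogeny_of_potentiallyGoodOrdinary) :
    EisensteinResidualOfTrichotomy :=
  fun hC1 hC2 hF _hCM hRay hCor ↦
    eisensteinAdditiveManinResidual_of_children_of_not_typeGOrd
      (fun W _ hred ↦ not_typeGOrd_oneSixtyThree_of_largePrimeReducibleJ hL W hred) hDD hC1 hC2 hF hRay hCor

end Summit.BirchSwinnertonDyer.BirchSwinnertonDyer.Theorems.TwistFamilyManinDescent.EisensteinTrichotomy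

end
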